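/-
Copyright (c) 2026 the pub-hodgecm-mathlib formalisation cell (harness21).  Prover seat hodgecm-mathlib-R90-CS-p03 (g3), R90-TF section S8 «ContSpec-n½» (dealer R90-CS-plan (g3),
S8-R198 (1) «the per-generator J-S8-SCAL rows OF RECORD»; census `R90/S8/CENSUS-ScalarRowsOfRecord.R90-CS-p03-g3.md`): the `hSCALrows` block of ★ (R)′ OF RECORD
`R90S8ResGMidBlockLeResidualOfRecordU3.res_midBlock_le_residual_of_record` (:166–:180) REDUCED, generator by generator and LEVEL-AGNOSTICALLY, to ONE named letter — the
UNFOLDING LETTER `hUNF : ∃ Ag M, hAg ∧ hM ∧ hψ2` — the three FLAG ④ rows `hAgm hAgB hAgN` being PAID from it (★ FLAG ④ p863864∕p863901, ★ `hcS` p863920, ★ constant-term invariances).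
-/
import Mathlib.Analysis.Complex.TaylorSeries                                                    -- `Complex.hasSum_taylorSeries_on_ball` (§1)
import Summits.HodgeConjecture.HodgeConjecture.Theorems.R90S8ResGMidBlockLeResidualOfRecordU3    -- ★ p863946 (K2E1-p12): the (R)′ OF RECORD head whose :166–:180 row this file feeds; brings the S8 frame, ★ `exists_bound_of_mem_chiSectionSpacePair_midBlock`, ★ `isUnitary_bcηInv_mul`
import Summits.HodgeConjecture.HodgeConjecture.Theorems.K2E1ChiIntertwinedAmplitudeInvarianceU3  -- ★ FLAG ④ p863864∕p863901 (R90-CS-p03 (g2)): `amplitude_comp_eq_threeHalves`, `psi_comp_eq_of_parts`, `measurable_psi_of_parts`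
import Summits.HodgeConjecture.HodgeConjecture.Theorems.K2E1ChiScalarRatioNonvanishingU3         -- ★ `hcS` p863920 (R90-CS-p03 (g2)): `scalarRatio_one_ne_zero`
import Summits.HodgeConjecture.HodgeConjecture.Theorems.K2E1BorelEisensteinRegularCMThree         -- ★ `continuous_eisensteinSeriesU_flatSectionU_cm_three` (`g ↦ E(φ_z)(g)` continuous, `2 < Re z`)
import Summits.HodgeConjecture.HodgeConjecture.Theorems.K2E1TruncatedEisensteinBoundedCMThree     -- ★ `eisensteinSeriesU_flatSectionU_arithmeticSubgroup_mul` (`E(φ_z)` is left-`G(F)`-invariant)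
import Literature.NumberTheory.Automorphic.UnitaryGroupBorelConstantTermInvariance              -- ★ `borelConstantTerm_rational_borel_mul` (`φ_B(b g) = φ_B(g)`, `b ∈ B(F)`)
import Literature.NumberTheory.Automorphic.UnitaryGroupUnipotentUnimodularThree                 -- ★ `borelConstantTerm_unipotent_mul_three` (`φ_B(n g) = φ_B(g)`, `n ∈ N(𝔸)`)
import Literature.NumberTheory.Automorphic.UnitaryGroupTruncatedKernelClassBorelCount           -- ★ `borelHeight_arithmeticBorel_mul` (`H(b g) = H(g)`, `b ∈ B(F)`)
import HarnessLib

/-!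
# K2·E1 ∕ R90·S8 — `K2E1ChiScalarRowsOfRecordU3`: THE J-S8-SCAL ROWS OF THE (R)′ OF RECORD, REDUCED TO THE UNFOLDING LETTER
# `hSCALrows` (★ p863946 :166–:180) ⇐ `hUNF : ∃ Ag M, (∀ g, Ag g holomorphic on {1<Re}) ∧ (∀ g, ‖Ag g (3∕2)‖ ≤ M) ∧ (ψ_z(g) = Ag g z·c_S(z) on {2<Re})`, per generator, at ANY level

Cell `pub/hodgecm-mathlib`, crux h413 = `stmt-HodgeConjecture-24833`, route of record `HCCMUnconditional`; R90-TF section S8 «ContSpec-n½», scalar road J-S8-SCAL.  THEOREMS ONLY (no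
`def`, no `instance`, no notation, no named-fact hypothesis, no `sorry`; default heartbeats); lane `--supports stmt-HodgeConjecture-24833 --as helper` (count-neutral).  Closes no socket.

WHAT.  ★ (R)′ OF RECORD `res_midBlock_le_residual_of_record` (K2E1-p12, p863946) carries, per generator `(K′, ω, φ, Ec, …)` of the middle block of `ξ` and per normalised Heisenberg package
`(ν, 𝓕)`, the row `hSCALrows` (:166–:180): `∃ Ag M` with (1) `hAg` every translate amplitude `Ag g` holomorphic on `{1 < Re}`, (2) `hM` the `g`-uniform bound `‖Ag g (3∕2)‖ ≤ M`, (3) `hψ2`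
the UNFOLDING identity `ψ_z(g) = Ag g z · c_S(z)` on `{2 < Re z}` at the def-free middle coefficient `ψ_z(g) := ((Ec z)_B(g) − φ(g)·H(g)^z) ∕ H(g)^{2−z}` (`c_S` bound ONCE with `hq : q = A·c_S`), and
the three profile rows (FLAG ④) (4) `hAgm : Measurable (g ↦ Ag g (3∕2))`, (5) `hAgB : Ag (b·x) (3∕2) = Ag x (3∕2)` for `b ∈ B(F)`, (6) `hAgN : Ag (u·g) (3∕2) = Ag g (3∕2)` for `u ∈ N(𝔸)`.
THIS FILE proves, for ONE generator at a time and WITHOUT any level condition (so in particular at the τ-admissible generators of ruling J-S8-ADM′ S8-R199), that (4)(5)(6) FOLLOW from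
(1)(3) and `c_S ≠ 0` on `{2 < Re}` (★ `hcS` p863920 at the ratio of record) — so that the `hSCALrows` block is ★ modulo exactly ONE named letter per generator, the UNFOLDING LETTER
`hUNF : ∃ Ag M, (1) ∧ (2) ∧ (3)` (the per-TRANSLATE section factorisation of the intertwining integral `M(z)φ_z(g) = Ag g z · c_S(z) · H(g)^{2−z}`, [MoeglinWaldspurger1995] II.1.7, IV.1.11;
★ (a-2b) `exists_pos_inv_measure_smul_integral_eq_chiEulerProduct_three`'s shape applied to `R(g)φ`; owner: the (a-2b)∕(a-3) supplier estate).

THE MATHEMATICS ([MoeglinWaldspurger1995] II.1.5, II.1.7, IV.1.11; [Rogawski1990] §2.1 p. 11, §13.9 p. 229; [Langlands1976] §7).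
* (5)(6): on `{2 < Re z}`, `Ec z = E(φ_z)` (row `hEis`) is left-`G(F)`-invariant (★ `eisensteinSeriesU_flatSectionU_arithmeticSubgroup_mul`, `φ` left-`B(F)`-invariant because `χ₂ = ξ.ψ` is
  automorphic, ★ `IsChiSectionPair.toAdelic_mul`), hence its Borel constant term is left-`B(F)`-invariant (★ `borelConstantTerm_rational_borel_mul`) and left-`N(𝔸)`-invariant (★
  `borelConstantTerm_unipotent_mul_three`); so are `φ` (★ `.unipotent_mul`; `B(F)` by ★ `map_principal` + ★ `apply_middleEntryUnitary_toAdelic_eq_one`) and `H` (★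
  `borelHeight_arithmeticBorel_mul`, ★ `borelHeight_unipotent_mul`); hence `ψ_z` is (★ FLAG ④ `psi_comp_eq_of_parts`), and ★ FLAG ④ `amplitude_comp_eq_threeHalves` transfers
  `ψ_z(Tg) = ψ_z(g)` on `{2<Re}` to `Ag (Tg) (3∕2) = Ag g (3∕2)` (identity theorem on the half-plane, `c_S ≠ 0`).
* (4): NEW route, no `hfac`∕`hρ`∕`hqc0` (compare ★ FLAG ④ §3): on `{2 < Re z}`, `Ag g z = ψ_z(g) ∕ c_S(z)` is MEASURABLE in `g` (indeed continuous: ★ `continuous_eisensteinSeriesU_flatSectionU_cm_three`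
  ∘ ★ `continuous_borelConstantTerm_of_continuous`, ★ `continuous_borelHeight`), and §1 propagates measurability in `g` from `{2 < Re}` to every point of `{1 < Re}` along holomorphy
  in `z`: the Taylor coefficients of `Ag g` at `c := z + 2 ∈ {2<Re}` are iterated slope-limits INSIDE `{2<Re}` (measurable, Mathlib `measurable_of_tendsto_metrizable'`), and the Taylor
  series at `c` converges to `Ag g z` on the ball of radius `Re z + 1 ∋ z` contained in `{1<Re}` (Mathlib `Complex.hasSum_taylorSeries_on_ball`).
* §1 `tendsto_add_inv_succ_nhdsNE`, `measurable_iteratedDeriv_of_two_lt_re`, HEAD-1 `measurable_apply_of_differentiableOn_of_measurable_two_lt_re` (generic: any measurable space `G`).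
* §2 HEAD-2 **`amplitudeRows_of_unfolding`** — ONE generator, ANY pair `(χ₁, χ₂)` with `χ₂` automorphic, any Haar `ν` and fundamental domain `𝓕` of compact closure: `(4) ∧ (5) ∧ (6)`.
* §3 HEAD-3 **`hSCALrows_of_unfoldingRows`** — ★ p863946 :166–:180 BYTES (all 22 generator binders verbatim) from the ∀-row `hUNF` (same binder prefix, body `(1) ∧ (2) ∧ (3)`) and
  `hcS0 : ∀ z, 2 < Re z → c_S z ≠ 0`; **`hSCALrows_of_unfoldingRows_of_record`** — the same at `c_S :=` ★ F5's `hsrc` ratio, `hcS0` DISCHARGED by ★ `scalarRatio_one_ne_zero` (letters: exactly `hUNF`).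
HONEST SCOPE.  NOT here: the unfolding letter `hUNF` itself (L; per-translate big-cell factorisation + Gindikin–Karpelevich at the good places; τ-admissible generators only, J-S8-ADM′).
HONEST LABEL: HC_CM is proved only modulo the 7 printed citations (2 remaining named inputs: hLiu418 = `stmt-HodgeConjecture-24832`, h413 = `stmt-HodgeConjecture-24833`) until rung 0
closes; REL ≠ ★ ≠ BUILT; this file asserts no named fact and closes no socket; §3 is conditional by construction on the row `hUNF` it names; count-neutral.

## References
* [MoeglinWaldspurger1995] C. Mœglin, J.-L. Waldspurger, *Spectral Decomposition and Eisenstein Series* (1995): II.1.5, II.1.7, IV.1.11.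
* [Rogawski1990] J. D. Rogawski, *Automorphic Representations of Unitary Groups in Three Variables*, Ann. of Math. Stud. 123 (1990): §2.1 p. 11, §13.9 p. 229.
* [Langlands1976] R. P. Langlands, *On the Functional Equations Satisfied by Eisenstein Series*, LNM 544 (1976): §7.
* [Titchmarsh1939] E. C. Titchmarsh, *The Theory of Functions*, 2nd ed. (1939): §2.4 (Taylor series), §3.3 (identity theorem).
-/

set_option autoImplicit false
set_option linter.dupNamespace false -- the mandated namespace repeats `HodgeConjecture.HodgeConjecture`

noncomputable section

open MeasureTheory Measure NumberField IsDedekindDomain Set Filter Topology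
open scoped ENNReal NNReal
open Literature.NumberTheory Literature.NumberTheory.Automorphic Literature.NumberTheory.Automorphic.UnitaryGroup Literature.NumberTheory.GaloisRepresentations AdelicGroupData
open Literature.NumberTheory.Automorphic.Arthur2013.Leaves.TECR Literature.NumberTheory.Rogawski1990 Literature.NumberTheory.LFunctions
open Summit.HodgeConjecture.HodgeConjecture.Cruxes.H413.K2E1BorelEisensteinU
open Summit.HodgeConjecture.HodgeConjecture.Cruxes.H413.K2E1CharacterEisensteinU2Defs
open Summit.HodgeConjecture.HodgeConjecture.Cruxes.H413.K2E1CharacterEisensteinU3PairDefs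
open Summit.HodgeConjecture.HodgeConjecture.Cruxes.H413.K2E1ChiSectionSpaceU3PairDefs
open Summit.HodgeConjecture.HodgeConjecture.Cruxes.H413.K2E1ChiIntertwinedAmplitudeInvarianceU3 (amplitude_comp_eq_threeHalves psi_comp_eq_of_parts measurable_psi_of_parts)
open Summit.HodgeConjecture.HodgeConjecture.Cruxes.H413.K2E1ChiScalarRatioNonvanishingU3 (scalarRatio_one_ne_zero)
open Summit.HodgeConjecture.HodgeConjecture.Cruxes.H413.K2E1BorelEisensteinRegularCMThree (continuous_eisensteinSeriesU_flatSectionU_cm_three)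
open Summit.HodgeConjecture.HodgeConjecture.Cruxes.H413.K2E1TruncatedEisensteinBoundedCMThree (eisensteinSeriesU_flatSectionU_arithmeticSubgroup_mul)
open Summit.HodgeConjecture.HodgeConjecture.Cruxes.H413.K2E1ChiConstantTermHolomorphicCMThree (continuous_borelConstantTerm_of_continuous)
open Summit.HodgeConjecture.HodgeConjecture.R90.S8 (exists_bound_of_mem_chiSectionSpacePair_midBlock isUnitary_bcηInv_mul)

namespace Summit.HodgeConjecture.HodgeConjecture.Cruxes.H413.K2E1ChiScalarRowsOfRecordU3

/-! ## §1 Measurability in `g` propagates from `{2 < Re}` to `{1 < Re}` along holomorphy in `z` -/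

section Measurability

variable {G : Type*} [MeasurableSpace G] (F : G → ℂ → ℂ) (hF : ∀ g, DifferentiableOn ℂ (F g) {z : ℂ | 1 < z.re})
  (hm : ∀ z : ℂ, 2 < z.re → Measurable fun g => F g z)

/-- The slope sequence `z + 1∕(k+1) → z` inside the punctured neighbourhood filter (real increments, never zero). [folklore] -/
theorem tendsto_add_inv_succ_nhdsNE (z : ℂ) : Tendsto (fun k : ℕ => z + (((1 : ℝ) / ((k : ℝ) + 1) : ℝ) : ℂ)) atTop (𝓝[≠] z) := by
  refine tendsto_nhdsWithin_iff.2 ⟨?_, Eventually.of_forall fun k => ?_⟩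
  · have h := (Complex.continuous_ofReal.tendsto 0).comp tendsto_one_div_add_atTop_nhds_zero_nat
    simpa only [Function.comp_def, Complex.ofReal_zero, add_zero] using tendsto_const_nhds.add h
  · have hk : (0 : ℝ) < 1 / ((k : ℝ) + 1) := by positivity
    intro h
    have h' : (((1 : ℝ) / ((k : ℝ) + 1) : ℝ) : ℂ) = 0 := by simpa using h
    exact hk.ne' (Complex.ofReal_eq_zero.1 h')

include hF hm in
/-- **THE TAYLOR COEFFICIENTS INSIDE `{2 < Re}` ARE MEASURABLE IN `g`**: for every `n` and every `z` with `2 < Re z`, `g ↦ (F g)^{(n)}(z)` is measurable — induction on `n`, the `(n+1)`-st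
derivative being the limit of the slopes of the `n`-th along `z + 1∕(k+1)` (points of `{2 < Re}`), a pointwise limit of measurable functions (Mathlib `measurable_of_tendsto_metrizable'`);
each `F g` is holomorphic, hence analytic with all derivatives, on the open half-plane `{1 < Re}`. [cite: Titchmarsh1939, §2.4] -/
theorem measurable_iteratedDeriv_of_two_lt_re (n : ℕ) : ∀ z : ℂ, 2 < z.re → Measurable fun g => iteratedDeriv n (F g) z := by
  induction n with
  | zero => simpa only [iteratedDeriv_zero] using hm
  | succ n ih =>
    intro z hz
    -- the `n`-th derivative of each `F g` is differentiable at `z`, with derivative the `(n+1)`-st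
    have hderiv : ∀ g, HasDerivAt (iteratedDeriv n (F g)) (iteratedDeriv (n + 1) (F g) z) z := fun g => by
      have han : AnalyticOnNhd ℂ (iteratedDeriv n (F g)) {z : ℂ | 1 < z.re} := by
        rw [iteratedDeriv_eq_iterate]
        exact ((hF g).analyticOnNhd (isOpen_lt continuous_const Complex.continuous_re)).iterated_deriv n
      rw [iteratedDeriv_succ]
      exact (han z (show (1 : ℝ) < z.re by linarith)).differentiableAt.hasDerivAt
    -- the slope points stay in `{2 < Re}`
    have hpt : ∀ k : ℕ, 2 < (z + (((1 : ℝ) / ((k : ℝ) + 1) : ℝ) : ℂ)).re := fun k => by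
      rw [Complex.add_re, Complex.ofReal_re]
      have hk : (0 : ℝ) < 1 / ((k : ℝ) + 1) := by positivity
      linarith
    refine measurable_of_tendsto_metrizable' atTop
      (f := fun (k : ℕ) (g : G) => slope (iteratedDeriv n (F g)) z (z + (((1 : ℝ) / ((k : ℝ) + 1) : ℝ) : ℂ))) (fun k => ?_) ?_
    · simp only [slope_def_field]
      exact ((ih _ (hpt k)).sub (ih z hz)).div_const _
    · exact tendsto_pi_nhds.2 fun g => (hasDerivAt_iff_tendsto_slope.1 (hderiv g)).comp (tendsto_add_inv_succ_nhdsNE z)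

include hF hm in
/-- **HEAD-1.  MEASURABILITY IN `g` PROPAGATES FROM `{2 < Re}` TO `{1 < Re}` ALONG HOLOMORPHY IN `z`.**  If every `F g` is holomorphic on `{1 < Re}` and `g ↦ F g z` is measurable for every
`z` with `2 < Re z`, then `g ↦ F g z` is measurable for every `z` with `1 < Re z`: the Taylor series of `F g` at `c := z + 2` (a point of `{2 < Re}`, measurable coefficients by
`measurable_iteratedDeriv_of_two_lt_re`) converges to `F g z` on the ball `B(c, Re z + 1) ∋ z`, which lies in `{1 < Re}` (Mathlib `Complex.hasSum_taylorSeries_on_ball`); partial sums are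
measurable and converge pointwise. [cite: Titchmarsh1939, §2.4] -/
theorem measurable_apply_of_differentiableOn_of_measurable_two_lt_re {z : ℂ} (hz : 1 < z.re) : Measurable fun g => F g z := by
  -- the centre `c = z + 2` and the ball `B(c, Re z + 1) ⊆ {1 < Re}` containing `z`
  have hc : 2 < (z + 2).re := by
    rw [Complex.add_re]
    norm_num
    linarith
  have hball : Metric.ball (z + 2) (z.re + 1) ⊆ {w : ℂ | 1 < w.re} := fun w hw => by
    have hn : ‖w - (z + 2)‖ < z.re + 1 := mem_ball_iff_norm.1 hw
    have hre : |(w - (z + 2)).re| ≤ ‖w - (z + 2)‖ := Complex.abs_re_le_norm _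
    have h1 := (abs_lt.1 (lt_of_le_of_lt hre hn)).1
    rw [Complex.sub_re, Complex.add_re] at h1
    show 1 < w.re
    norm_num at h1
    linarith
  have hzball : z ∈ Metric.ball (z + 2) (z.re + 1) := by
    rw [mem_ball_iff_norm, sub_add_cancel_left, norm_neg]
    have h2 : ‖(2 : ℂ)‖ = 2 := by simp
    rw [h2]
    linarith
  have hsum : ∀ g, HasSum (fun n : ℕ => ((n.factorial : ℕ) : ℂ)⁻¹ • (z - (z + 2)) ^ n • iteratedDeriv n (F g) (z + 2)) (F g z) := fun g =>
    Complex.hasSum_taylorSeries_on_ball ((hF g).mono hball) hzball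
  refine measurable_of_tendsto_metrizable' atTop
    (f := fun (N : ℕ) (g : G) => ∑ n ∈ Finset.range N, ((n.factorial : ℕ) : ℂ)⁻¹ • (z - (z + 2)) ^ n • iteratedDeriv n (F g) (z + 2)) (fun N => ?_) ?_
  · refine Finset.measurable_sum _ fun n _ => ?_
    simp only [smul_eq_mul]
    exact ((measurable_iteratedDeriv_of_two_lt_re F hF hm n (z + 2) hc).const_mul _).const_mul _
  · exact tendsto_pi_nhds.2 fun g => (hsum g).tendsto_sum_nat

end Measurability

/-! ## §2 One generator: the three profile rows `hAgm hAgB hAgN` from the unfolding letter -/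

section OneGenerator

variable (L : Type) [Field L] [NumberField L] [IsCMField L]
  [MeasurableSpace (quasiSplit (↥(maximalRealSubfield L)) L (IsCMField.complexConj L) 3).Adelic] [BorelSpace (quasiSplit (↥(maximalRealSubfield L)) L (IsCMField.complexConj L) 3).Adelic]

/-- `1 < Re(3∕2)`. [folklore] -/
theorem one_lt_re_threeHalves : (1 : ℝ) < ((3 : ℂ) / 2).re := by norm_num

/-- **HEAD-2.  THE PROFILE ROWS OF ONE GENERATOR FROM ITS UNFOLDING LETTER** — any pair `(χ₁, χ₂)` with `χ₂` AUTOMORPHIC, any continuous bounded `(χ₁, χ₂)`-pair section `φ` of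
`U(J₃)(𝔸_{L⁺})`, any family `Ec` with `Ec z = E(φ_z)` on `{2 < Re}` (`hEis`), any Haar `ν` of `N(𝔸_{L⁺})` with a fundamental domain `𝓕` of `N(L⁺)` of compact closure, any scalar `c_S`
non-vanishing on `{2 < Re}` (`hcS`), and translate amplitudes `Ag` holomorphic on `{1 < Re}` (`hAg`) with the UNFOLDING IDENTITY `hψ2 : ψ_z(g) = Ag g z·c_S z` on `{2 < Re}` at
`ψ_z(g) := ((Ec z)_B(g) − φ(g)·H(g)^z) ∕ H(g)^{2−z}`: THEN `g ↦ Ag g (3∕2)` is MEASURABLE (§1 at `z = 3∕2`, fed on `{2<Re}` by `Ag g z = ψ_z(g) ∕ c_S z`, `ψ_z` continuous ★), and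
`Ag (b·x) (3∕2) = Ag x (3∕2)` (`b ∈ B(L⁺)`), `Ag (u·g) (3∕2) = Ag g (3∕2)` (`u ∈ N(𝔸_{L⁺})`) (★ FLAG ④ `amplitude_comp_eq_threeHalves` ∘ `psi_comp_eq_of_parts`, the invariances of
`(E(φ_z))_B`, `φ`, `H` being ★).  No level condition on `φ` is used. [cite: MoeglinWaldspurger1995, II.1.5, II.1.7, IV.1.11] [cite: Rogawski1990, §2.1 p. 11, §13.9 p. 229] [cite: Langlands1976, §7] -/
theorem amplitudeRows_of_unfolding
    {χ₁ : HeckeCharacter L} {χ₂ : ↥(TorusDict.torus (IsCMField.complexConj L)) →ₜ* ℂˣ} (hχ₂ : TorusDict.IsAutomorphic (IsCMField.complexConj L) χ₂)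
    {φ : (quasiSplit (↥(maximalRealSubfield L)) L (IsCMField.complexConj L) 3).Adelic → ℂ} (hφ : IsChiSectionPair χ₁ χ₂ φ) (hφc : Continuous φ) {Mφ : ℝ} (hφM : ∀ x, ‖φ x‖ ≤ Mφ)
    (Ec : ℂ → (quasiSplit (↥(maximalRealSubfield L)) L (IsCMField.complexConj L) 3).Adelic → ℂ) (hEis : ∀ z : ℂ, 2 < z.re → Ec z = eisensteinSeriesU (flatSectionU φ z))
    (ν : Measure ↥(adelicUnipotent (↥(maximalRealSubfield L)) L (IsCMField.complexConj L) 3)) [ν.IsHaarMeasure] {𝓕 : Set ↥(adelicUnipotent (↥(maximalRealSubfield L)) L (IsCMField.complexConj L) 3)}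
    (h𝓕N : IsFundamentalDomain ↥(rationalUnipotent (↥(maximalRealSubfield L)) L (IsCMField.complexConj L) 3) 𝓕 ν) (h𝓕c : IsCompact (closure 𝓕))
    (cS : ℂ → ℂ) (hcS : ∀ z : ℂ, 2 < z.re → cS z ≠ 0)
    (Ag : (quasiSplit (↥(maximalRealSubfield L)) L (IsCMField.complexConj L) 3).Adelic → ℂ → ℂ) (hAg : ∀ g, DifferentiableOn ℂ (Ag g) {z : ℂ | 1 < z.re})
    (hψ2 : ∀ z : ℂ, 2 < z.re → ∀ g : (quasiSplit (↥(maximalRealSubfield L)) L (IsCMField.complexConj L) 3).Adelic,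
      (borelConstantTerm ν 𝓕 (Ec z) g - φ g * (((borelHeight g : ℝ≥0) : ℝ) : ℂ) ^ z) / (((borelHeight g : ℝ≥0) : ℝ) : ℂ) ^ (2 - z) = Ag g z * cS z) :
    (Measurable fun g : (quasiSplit (↥(maximalRealSubfield L)) L (IsCMField.complexConj L) 3).Adelic => Ag g ((3 : ℂ) / 2)) ∧
    (∀ b ∈ arithmeticBorel (↥(maximalRealSubfield L)) L (IsCMField.complexConj L) 3, ∀ x : (quasiSplit (↥(maximalRealSubfield L)) L (IsCMField.complexConj L) 3).Adelic,
      Ag ((b : (quasiSplit (↥(maximalRealSubfield L)) L (IsCMField.complexConj L) 3).Adelic) * x) ((3 : ℂ) / 2) = Ag x ((3 : ℂ) / 2)) ∧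
    (∀ (u : ↥(adelicUnipotent (↥(maximalRealSubfield L)) L (IsCMField.complexConj L) 3)) (g : (quasiSplit (↥(maximalRealSubfield L)) L (IsCMField.complexConj L) 3).Adelic),
      Ag ((u : (quasiSplit (↥(maximalRealSubfield L)) L (IsCMField.complexConj L) 3).Adelic) * g) ((3 : ℂ) / 2) = Ag g ((3 : ℂ) / 2)) := by
  have hc : IsCMField.complexConj L * IsCMField.complexConj L = 1 := AlgEquiv.ext fun x => IsCMField.complexConj_apply_apply L x
  -- the def-free middle coefficient `ψ`
  set ψ : ℂ → (quasiSplit (↥(maximalRealSubfield L)) L (IsCMField.complexConj L) 3).Adelic → ℂ :=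
    fun z g => (borelConstantTerm ν 𝓕 (Ec z) g - φ g * (((borelHeight g : ℝ≥0) : ℝ) : ℂ) ^ z) / (((borelHeight g : ℝ≥0) : ℝ) : ℂ) ^ (2 - z) with hψdef
  have hψ2' : ∀ z : ℂ, 2 < z.re → ∀ g, ψ z g = Ag g z * cS z := hψ2
  -- `φ` is left-`B(F)`-invariant (on `G(F)`-points) since `χ₂` is automorphic
  have hφU : ∀ b ∈ borelU ((IsCMField.complexConj L : L ≃ₐ[↥(maximalRealSubfield L)] L) : L →+* L) ((StdForm.antidiagonal 3).over L),
      ∀ x : (quasiSplit (↥(maximalRealSubfield L)) L (IsCMField.complexConj L) 3).Adelic, φ ((quasiSplit (↥(maximalRealSubfield L)) L (IsCMField.complexConj L) 3).toAdelic b * x) = φ x :=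
    hφ.toAdelic_mul hχ₂
  have hφB : ∀ b ∈ arithmeticBorel (↥(maximalRealSubfield L)) L (IsCMField.complexConj L) 3, ∀ x : (quasiSplit (↥(maximalRealSubfield L)) L (IsCMField.complexConj L) 3).Adelic,
      φ ((b : (quasiSplit (↥(maximalRealSubfield L)) L (IsCMField.complexConj L) 3).Adelic) * x) = φ x := fun b hb x => by
    obtain ⟨r, hr⟩ := b.2
    have hrB : (quasiSplit (↥(maximalRealSubfield L)) L (IsCMField.complexConj L) 3).toAdelic r ∈ borelAdelic (↥(maximalRealSubfield L)) L (IsCMField.complexConj L) 3 := by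
      rw [hr]
      exact (mem_arithmeticBorel_iff b).1 hb
    rw [← hr, hφ.borel_mul hrB, HeckeCharacter.map_principal χ₁ (firstEntryUnit_toAdelic_mem_principalIdeles r hrB), apply_middleEntryUnitary_toAdelic_eq_one hχ₂ r hrB, Units.val_one,
      one_mul, one_mul]
  -- on `{2 < Re}`: `Ec z = E(φ_z)` is left-`G(F)`-invariant, hence its constant term is left-`B(F)`- and left-`N(𝔸)`-invariant, and continuous
  have hEG : ∀ z : ℂ, 2 < z.re → ∀ (γ : (quasiSplit (↥(maximalRealSubfield L)) L (IsCMField.complexConj L) 3).arithmeticSubgroup)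
      (x : (quasiSplit (↥(maximalRealSubfield L)) L (IsCMField.complexConj L) 3).Adelic), Ec z ((γ : (quasiSplit (↥(maximalRealSubfield L)) L (IsCMField.complexConj L) 3).Adelic) * x) = Ec z x :=
    fun z hz γ x => by
      rw [hEis z hz]
      exact eisensteinSeriesU_flatSectionU_arithmeticSubgroup_mul hφU z γ x
  have hCTB : ∀ z : ℂ, 2 < z.re → ∀ b ∈ arithmeticBorel (↥(maximalRealSubfield L)) L (IsCMField.complexConj L) 3, ∀ x : (quasiSplit (↥(maximalRealSubfield L)) L (IsCMField.complexConj L) 3).Adelic,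
      borelConstantTerm ν 𝓕 (Ec z) ((b : (quasiSplit (↥(maximalRealSubfield L)) L (IsCMField.complexConj L) 3).Adelic) * x) = borelConstantTerm ν 𝓕 (Ec z) x :=
    fun z hz b hb x => borelConstantTerm_rational_borel_mul ν h𝓕N (fun b' _ y => hEG z hz b' y) b hb x
  have hCTN : ∀ z : ℂ, 2 < z.re → ∀ (u : ↥(adelicUnipotent (↥(maximalRealSubfield L)) L (IsCMField.complexConj L) 3)) (x : (quasiSplit (↥(maximalRealSubfield L)) L (IsCMField.complexConj L) 3).Adelic),
      borelConstantTerm ν 𝓕 (Ec z) ((u : (quasiSplit (↥(maximalRealSubfield L)) L (IsCMField.complexConj L) 3).Adelic) * x) = borelConstantTerm ν 𝓕 (Ec z) x :=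
    fun z hz u x => borelConstantTerm_unipotent_mul_three hc ν h𝓕N (fun u' hu' y => hEG z hz ⟨_, hu'⟩ y) u x
  -- `ψ_z` is left-`B(F)`- and left-`N(𝔸)`-invariant on `{2 < Re}`
  have hψB : ∀ z : ℂ, 2 < z.re → ∀ b ∈ arithmeticBorel (↥(maximalRealSubfield L)) L (IsCMField.complexConj L) 3, ∀ x : (quasiSplit (↥(maximalRealSubfield L)) L (IsCMField.complexConj L) 3).Adelic,
      ψ z ((b : (quasiSplit (↥(maximalRealSubfield L)) L (IsCMField.complexConj L) 3).Adelic) * x) = ψ z x := fun z hz b hb x =>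
    psi_comp_eq_of_parts (fun z g => borelConstantTerm ν 𝓕 (Ec z) g) φ borelHeight (fun x => (b : (quasiSplit (↥(maximalRealSubfield L)) L (IsCMField.complexConj L) 3).Adelic) * x) z
      (hCTB z hz b hb) (hφB b hb) (fun y => borelHeight_arithmeticBorel_mul hb y) x
  have hψN : ∀ z : ℂ, 2 < z.re → ∀ (u : ↥(adelicUnipotent (↥(maximalRealSubfield L)) L (IsCMField.complexConj L) 3)) (g : (quasiSplit (↥(maximalRealSubfield L)) L (IsCMField.complexConj L) 3).Adelic),
      ψ z ((u : (quasiSplit (↥(maximalRealSubfield L)) L (IsCMField.complexConj L) 3).Adelic) * g) = ψ z g := fun z hz u g =>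
    psi_comp_eq_of_parts (fun z g => borelConstantTerm ν 𝓕 (Ec z) g) φ borelHeight (fun g => (u : (quasiSplit (↥(maximalRealSubfield L)) L (IsCMField.complexConj L) 3).Adelic) * g) z
      (hCTN z hz u) (fun y => hφ.unipotent_mul u y) (fun y => borelHeight_unipotent_mul u.2 y) g
  -- `ψ_z` is measurable on `{2 < Re}` (continuity of `E(φ_z)`, of its constant term, of `φ` and of `H`)
  have h𝓕top : ν 𝓕 ≠ ∞ := ((measure_mono subset_closure).trans_lt h𝓕c.measure_lt_top).ne
  have hψm : ∀ z : ℂ, 2 < z.re → Measurable (ψ z) := fun z hz => by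
    have hEc : Continuous (Ec z) := by
      rw [hEis z hz]
      exact continuous_eisensteinSeriesU_flatSectionU_cm_three L hz hφc hφM
    exact measurable_psi_of_parts (fun z g => borelConstantTerm ν 𝓕 (Ec z) g) φ borelHeight z
      (continuous_borelConstantTerm_of_continuous ν h𝓕N.nullMeasurableSet h𝓕top h𝓕c hEc).measurable hφc.measurable continuous_borelHeight.measurable
  -- on `{2 < Re}`: `Ag g z = ψ_z(g) ∕ c_S(z)` is measurable in `g`; §1 propagates to `3∕2`
  have hAm : ∀ z : ℂ, 2 < z.re → Measurable fun g => Ag g z := fun z hz => by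
    have heq : (fun g => Ag g z) = fun g => ψ z g / cS z := funext fun g => by rw [hψ2' z hz g, mul_div_cancel_right₀ _ (hcS z hz)]
    rw [heq]
    exact (hψm z hz).div_const _
  refine ⟨measurable_apply_of_differentiableOn_of_measurable_two_lt_re Ag hAg hAm one_lt_re_threeHalves, fun b hb x => ?_, fun u g => ?_⟩
  · exact amplitude_comp_eq_threeHalves ψ Ag cS hAg hψ2' hcS (fun x => (b : (quasiSplit (↥(maximalRealSubfield L)) L (IsCMField.complexConj L) 3).Adelic) * x) (fun z hz x => hψB z hz b hb x) x
  · exact amplitude_comp_eq_threeHalves ψ Ag cS hAg hψ2' hcS (fun g => (u : (quasiSplit (↥(maximalRealSubfield L)) L (IsCMField.complexConj L) 3).Adelic) * g) (fun z hz g => hψN z hz u g) g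

end OneGenerator

/-! ## §3 HEAD: ★ p863946's `hSCALrows` row (:166–:180, bytes) from the ∀-row `hUNF` -/

section OfRecord

variable (L : Type) [Field L] [NumberField L] [IsCMField L]
  [MeasurableSpace (quasiSplit (↥(maximalRealSubfield L)) L (IsCMField.complexConj L) 3).Adelic] [BorelSpace (quasiSplit (↥(maximalRealSubfield L)) L (IsCMField.complexConj L) 3).Adelic]

/-- **HEAD-3.  THE `hSCALrows` ROW OF ★ (R)′ OF RECORD FROM THE UNFOLDING ROW** (★ `res_midBlock_le_residual_of_record` :166–:180, byte for byte): at the socket frame `(L μ μω hμu ξ)`, for a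
scalar `c_S` non-vanishing on `{2 < Re}` (`hcS0`; of record ★ `scalarRatio_one_ne_zero`, see `hSCALrows_of_unfoldingRows_of_record`), the per-generator UNFOLDING ROW `hUNF` — same 22
binders as `hSCALrows`, body `∃ Ag M, hAg ∧ hM ∧ hψ2` — yields `hSCALrows` (§2 per generator; `φ` bounded by ★ `exists_bound_of_mem_chiSectionSpacePair_midBlock`, `χ₂ = ξ.ψ` automorphic
by `ξ.hψ`).  Consumers restricted to τ-admissible generators (J-S8-ADM′) call §2 `amplitudeRows_of_unfolding` per generator instead.
[cite: MoeglinWaldspurger1995, II.1.7, IV.1.11] [cite: Rogawski1990, §13.9 p. 229] [cite: Langlands1976, §7] -/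
theorem hSCALrows_of_unfoldingRows
    (μ : Measure (quasiSplit (↥(maximalRealSubfield L)) L (IsCMField.complexConj L) 3).automorphicQuotient) [(quasiSplit (↥(maximalRealSubfield L)) L (IsCMField.complexConj L) 3).IsAutomorphicMeasure μ]
    (μω : HeckeCharacter L) (hμu : μω.IsUnitary) (ξ : OneDimAutRepH L)
    (cS : ℂ → ℂ) (hcS0 : ∀ z : ℂ, 2 < z.re → cS z ≠ 0)
    (hUNF : ∀ (K' : Subgroup (quasiSplit (↥(maximalRealSubfield L)) L (IsCMField.complexConj L) 3).Adelic) (ω : ↥K' →* ℂ)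
      (φ : (quasiSplit (↥(maximalRealSubfield L)) L (IsCMField.complexConj L) 3).Adelic → ℂ) (_ : φ ∈ chiSectionSpacePair (ξ.bcη⁻¹ * ξ.bcψ⁻¹ * μω) ξ.ψ K' (ω : ↥K' → ℂ)) (_ : Continuous φ)
      (Ec : ℂ → (quasiSplit (↥(maximalRealSubfield L)) L (IsCMField.complexConj L) 3).Adelic → ℂ) (Sp : Finset ℂ) (_ : ∀ s ∈ Sp, s.im = 0 ∧ 1 < s.re ∧ s.re ≤ 2)
      (_ : ∀ g, DifferentiableOn ℂ (fun z => Ec z g) ({z : ℂ | 1 < z.re} \ (↑Sp : Set ℂ)))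
      (_ : ∀ z : ℂ, 2 < z.re → Ec z = eisensteinSeriesU (flatSectionU φ z))
      (Fp : (quasiSplit (↥(maximalRealSubfield L)) L (IsCMField.complexConj L) 3).Adelic → ℂ → ℂ) (_ : ∀ g, AnalyticAt ℂ (Fp g) ((3 : ℂ) / 2))
      (_ : ∀ g, Fp g =ᶠ[𝓝[≠] ((3 : ℂ) / 2)] fun z => (z - (3 : ℂ) / 2) * Ec z g)
      (f : (quasiSplit (↥(maximalRealSubfield L)) L (IsCMField.complexConj L) 3).L2 μ) (_ : (f : (quasiSplit (↥(maximalRealSubfield L)) L (IsCMField.complexConj L) 3).automorphicQuotient → ℂ) =ᵐ[μ] fun x => Fp (Quotient.out (x : (quasiSplit (↥(maximalRealSubfield L)) L (IsCMField.complexConj L) 3).Adelic ⧸ (quasiSplit (↥(maximalRealSubfield L)) L (IsCMField.complexConj L) 3).quotientSubgroup))⁻¹ ((3 : ℂ) / 2))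
      (ν : Measure ↥(adelicUnipotent (↥(maximalRealSubfield L)) L (IsCMField.complexConj L) 3)) (_ : ν.IsHaarMeasure) (𝓕 : Set ↥(adelicUnipotent (↥(maximalRealSubfield L)) L (IsCMField.complexConj L) 3)) (_ : IsFundamentalDomain ↥(rationalUnipotent (↥(maximalRealSubfield L)) L (IsCMField.complexConj L) 3) 𝓕 ν) (_ : IsCompact (closure 𝓕)) (_ : ν.IsInvInvariant) (_ : ν 𝓕 = 1),
      ∃ (Ag : (quasiSplit (↥(maximalRealSubfield L)) L (IsCMField.complexConj L) 3).Adelic → ℂ → ℂ) (M : ℝ),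
        (∀ g, DifferentiableOn ℂ (Ag g) {z : ℂ | 1 < z.re}) ∧ (∀ g, ‖Ag g (3 / 2)‖ ≤ M) ∧
        (∀ z : ℂ, 2 < z.re → ∀ g : (quasiSplit (↥(maximalRealSubfield L)) L (IsCMField.complexConj L) 3).Adelic, (borelConstantTerm ν 𝓕 (Ec z) g - φ g * (((borelHeight g : ℝ≥0) : ℝ) : ℂ) ^ z) / (((borelHeight g : ℝ≥0) : ℝ) : ℂ) ^ (2 - z) = Ag g z * cS z)) :
    ∀ (K' : Subgroup (quasiSplit (↥(maximalRealSubfield L)) L (IsCMField.complexConj L) 3).Adelic) (ω : ↥K' →* ℂ)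
      (φ : (quasiSplit (↥(maximalRealSubfield L)) L (IsCMField.complexConj L) 3).Adelic → ℂ) (_ : φ ∈ chiSectionSpacePair (ξ.bcη⁻¹ * ξ.bcψ⁻¹ * μω) ξ.ψ K' (ω : ↥K' → ℂ)) (_ : Continuous φ)
      (Ec : ℂ → (quasiSplit (↥(maximalRealSubfield L)) L (IsCMField.complexConj L) 3).Adelic → ℂ) (Sp : Finset ℂ) (_ : ∀ s ∈ Sp, s.im = 0 ∧ 1 < s.re ∧ s.re ≤ 2)
      (_ : ∀ g, DifferentiableOn ℂ (fun z => Ec z g) ({z : ℂ | 1 < z.re} \ (↑Sp : Set ℂ)))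
      (_ : ∀ z : ℂ, 2 < z.re → Ec z = eisensteinSeriesU (flatSectionU φ z))
      (Fp : (quasiSplit (↥(maximalRealSubfield L)) L (IsCMField.complexConj L) 3).Adelic → ℂ → ℂ) (_ : ∀ g, AnalyticAt ℂ (Fp g) ((3 : ℂ) / 2))
      (_ : ∀ g, Fp g =ᶠ[𝓝[≠] ((3 : ℂ) / 2)] fun z => (z - (3 : ℂ) / 2) * Ec z g)
      (f : (quasiSplit (↥(maximalRealSubfield L)) L (IsCMField.complexConj L) 3).L2 μ) (_ : (f : (quasiSplit (↥(maximalRealSubfield L)) L (IsCMField.complexConj L) 3).automorphicQuotient → ℂ) =ᵐ[μ] fun x => Fp (Quotient.out (x : (quasiSplit (↥(maximalRealSubfield L)) L (IsCMField.complexConj L) 3).Adelic ⧸ (quasiSplit (↥(maximalRealSubfield L)) L (IsCMField.complexConj L) 3).quotientSubgroup))⁻¹ ((3 : ℂ) / 2))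
      (ν : Measure ↥(adelicUnipotent (↥(maximalRealSubfield L)) L (IsCMField.complexConj L) 3)) (_ : ν.IsHaarMeasure) (𝓕 : Set ↥(adelicUnipotent (↥(maximalRealSubfield L)) L (IsCMField.complexConj L) 3)) (_ : IsFundamentalDomain ↥(rationalUnipotent (↥(maximalRealSubfield L)) L (IsCMField.complexConj L) 3) 𝓕 ν) (_ : IsCompact (closure 𝓕)) (_ : ν.IsInvInvariant) (_ : ν 𝓕 = 1),
      ∃ (Ag : (quasiSplit (↥(maximalRealSubfield L)) L (IsCMField.complexConj L) 3).Adelic → ℂ → ℂ) (M : ℝ),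
        (∀ g, DifferentiableOn ℂ (Ag g) {z : ℂ | 1 < z.re}) ∧ (∀ g, ‖Ag g (3 / 2)‖ ≤ M) ∧
        (∀ z : ℂ, 2 < z.re → ∀ g : (quasiSplit (↥(maximalRealSubfield L)) L (IsCMField.complexConj L) 3).Adelic, (borelConstantTerm ν 𝓕 (Ec z) g - φ g * (((borelHeight g : ℝ≥0) : ℝ) : ℂ) ^ z) / (((borelHeight g : ℝ≥0) : ℝ) : ℂ) ^ (2 - z) = Ag g z * cS z) ∧
        (Measurable fun g : (quasiSplit (↥(maximalRealSubfield L)) L (IsCMField.complexConj L) 3).Adelic => Ag g ((3 : ℂ) / 2)) ∧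
        (∀ b ∈ arithmeticBorel (↥(maximalRealSubfield L)) L (IsCMField.complexConj L) 3, ∀ x : (quasiSplit (↥(maximalRealSubfield L)) L (IsCMField.complexConj L) 3).Adelic, Ag ((b : (quasiSplit (↥(maximalRealSubfield L)) L (IsCMField.complexConj L) 3).Adelic) * x) ((3 : ℂ) / 2) = Ag x ((3 : ℂ) / 2)) ∧
        (∀ (u : ↥(adelicUnipotent (↥(maximalRealSubfield L)) L (IsCMField.complexConj L) 3)) (g : (quasiSplit (↥(maximalRealSubfield L)) L (IsCMField.complexConj L) 3).Adelic), Ag ((u : (quasiSplit (↥(maximalRealSubfield L)) L (IsCMField.complexConj L) 3).Adelic) * g) ((3 : ℂ) / 2) = Ag g ((3 : ℂ) / 2)) := by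
  intro K' ω φ hφV hφc Ec Sp hSp hhol hEis Fp hFp hFpE f hf ν hν 𝓕 h𝓕N h𝓕c hinv h𝓕1
  haveI := hν
  obtain ⟨Ag, M, hAg, hM, hψ2⟩ := hUNF K' ω φ hφV hφc Ec Sp hSp hhol hEis Fp hFp hFpE f hf ν hν 𝓕 h𝓕N h𝓕c hinv h𝓕1
  obtain ⟨Mφ, hφM⟩ := exists_bound_of_mem_chiSectionSpacePair_midBlock L ξ hμu hφV hφc
  obtain ⟨hAgm, hAgB, hAgN⟩ := amplitudeRows_of_unfolding L ξ.hψ (isChiSectionPair_of_mem hφV) hφc hφM Ec hEis ν h𝓕N h𝓕c cS hcS0 Ag hAg hψ2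
  exact ⟨Ag, M, hAg, hM, hψ2, hAgm, hAgB, hAgN⟩

/-- **HEAD-3 AT THE SCALAR OF RECORD: `c_S :=` ★ F5's `hsrc` ratio `(L^S(z−1, ξ.bcη⁻¹·μω)·L^{T′}(2z−2, 1)) ∕ (L^S(z, ξ.bcη⁻¹·μω)·L^{T′}(2z−1, 1))`** — `hcS0` DISCHARGED by ★ `scalarRatio_one_ne_zero`
(`ξ.bcη⁻¹·μω` unitary, ★ `isUnitary_bcηInv_mul`), so the `hSCALrows` row of ★ (R)′ OF RECORD (with its `cS` binder so instantiated, `hq := hsrc`) is ★ modulo exactly the unfolding row `hUNF`.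
[cite: MoeglinWaldspurger1995, II.1.7, IV.1.11] [cite: Rogawski1990, §13.9 p. 229] -/
theorem hSCALrows_of_unfoldingRows_of_record
    (μ : Measure (quasiSplit (↥(maximalRealSubfield L)) L (IsCMField.complexConj L) 3).automorphicQuotient) [(quasiSplit (↥(maximalRealSubfield L)) L (IsCMField.complexConj L) 3).IsAutomorphicMeasure μ]
    (μω : HeckeCharacter L) (hμu : μω.IsUnitary) (ξ : OneDimAutRepH L)
    (S : Set (HeightOneSpectrum (𝓞 L))) (T' : Set (HeightOneSpectrum (𝓞 ↥(maximalRealSubfield L))))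
    (hUNF : ∀ (K' : Subgroup (quasiSplit (↥(maximalRealSubfield L)) L (IsCMField.complexConj L) 3).Adelic) (ω : ↥K' →* ℂ)
      (φ : (quasiSplit (↥(maximalRealSubfield L)) L (IsCMField.complexConj L) 3).Adelic → ℂ) (_ : φ ∈ chiSectionSpacePair (ξ.bcη⁻¹ * ξ.bcψ⁻¹ * μω) ξ.ψ K' (ω : ↥K' → ℂ)) (_ : Continuous φ)
      (Ec : ℂ → (quasiSplit (↥(maximalRealSubfield L)) L (IsCMField.complexConj L) 3).Adelic → ℂ) (Sp : Finset ℂ) (_ : ∀ s ∈ Sp, s.im = 0 ∧ 1 < s.re ∧ s.re ≤ 2)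
      (_ : ∀ g, DifferentiableOn ℂ (fun z => Ec z g) ({z : ℂ | 1 < z.re} \ (↑Sp : Set ℂ)))
      (_ : ∀ z : ℂ, 2 < z.re → Ec z = eisensteinSeriesU (flatSectionU φ z))
      (Fp : (quasiSplit (↥(maximalRealSubfield L)) L (IsCMField.complexConj L) 3).Adelic → ℂ → ℂ) (_ : ∀ g, AnalyticAt ℂ (Fp g) ((3 : ℂ) / 2))
      (_ : ∀ g, Fp g =ᶠ[𝓝[≠] ((3 : ℂ) / 2)] fun z => (z - (3 : ℂ) / 2) * Ec z g)
      (f : (quasiSplit (↥(maximalRealSubfield L)) L (IsCMField.complexConj L) 3).L2 μ) (_ : (f : (quasiSplit (↥(maximalRealSubfield L)) L (IsCMField.complexConj L) 3).automorphicQuotient → ℂ) =ᵐ[μ] fun x => Fp (Quotient.out (x : (quasiSplit (↥(maximalRealSubfield L)) L (IsCMField.complexConj L) 3).Adelic ⧸ (quasiSplit (↥(maximalRealSubfield L)) L (IsCMField.complexConj L) 3).quotientSubgroup))⁻¹ ((3 : ℂ) / 2))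
      (ν : Measure ↥(adelicUnipotent (↥(maximalRealSubfield L)) L (IsCMField.complexConj L) 3)) (_ : ν.IsHaarMeasure) (𝓕 : Set ↥(adelicUnipotent (↥(maximalRealSubfield L)) L (IsCMField.complexConj L) 3)) (_ : IsFundamentalDomain ↥(rationalUnipotent (↥(maximalRealSubfield L)) L (IsCMField.complexConj L) 3) 𝓕 ν) (_ : IsCompact (closure 𝓕)) (_ : ν.IsInvInvariant) (_ : ν 𝓕 = 1),
      ∃ (Ag : (quasiSplit (↥(maximalRealSubfield L)) L (IsCMField.complexConj L) 3).Adelic → ℂ → ℂ) (M : ℝ),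
        (∀ g, DifferentiableOn ℂ (Ag g) {z : ℂ | 1 < z.re}) ∧ (∀ g, ‖Ag g (3 / 2)‖ ≤ M) ∧
        (∀ z : ℂ, 2 < z.re → ∀ g : (quasiSplit (↥(maximalRealSubfield L)) L (IsCMField.complexConj L) 3).Adelic, (borelConstantTerm ν 𝓕 (Ec z) g - φ g * (((borelHeight g : ℝ≥0) : ℝ) : ℂ) ^ z) / (((borelHeight g : ℝ≥0) : ℝ) : ℂ) ^ (2 - z) = Ag g z *
          ((partialStandardL S (fun w => {(ξ.bcη⁻¹ * μω).valueAtUniformizer w}) (z - 1) * partialStandardL T' (fun v => {(1 : HeckeCharacter ↥(maximalRealSubfield L)).valueAtUniformizer v}) (2 * z - 2)) /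
            (partialStandardL S (fun w => {(ξ.bcη⁻¹ * μω).valueAtUniformizer w}) z * partialStandardL T' (fun v => {(1 : HeckeCharacter ↥(maximalRealSubfield L)).valueAtUniformizer v}) (2 * z - 1))))) :
    ∀ (K' : Subgroup (quasiSplit (↥(maximalRealSubfield L)) L (IsCMField.complexConj L) 3).Adelic) (ω : ↥K' →* ℂ)
      (φ : (quasiSplit (↥(maximalRealSubfield L)) L (IsCMField.complexConj L) 3).Adelic → ℂ) (_ : φ ∈ chiSectionSpacePair (ξ.bcη⁻¹ * ξ.bcψ⁻¹ * μω) ξ.ψ K' (ω : ↥K' → ℂ)) (_ : Continuous φ)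
      (Ec : ℂ → (quasiSplit (↥(maximalRealSubfield L)) L (IsCMField.complexConj L) 3).Adelic → ℂ) (Sp : Finset ℂ) (_ : ∀ s ∈ Sp, s.im = 0 ∧ 1 < s.re ∧ s.re ≤ 2)
      (_ : ∀ g, DifferentiableOn ℂ (fun z => Ec z g) ({z : ℂ | 1 < z.re} \ (↑Sp : Set ℂ)))
      (_ : ∀ z : ℂ, 2 < z.re → Ec z = eisensteinSeriesU (flatSectionU φ z))
      (Fp : (quasiSplit (↥(maximalRealSubfield L)) L (IsCMField.complexConj L) 3).Adelic → ℂ → ℂ) (_ : ∀ g, AnalyticAt ℂ (Fp g) ((3 : ℂ) / 2))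
      (_ : ∀ g, Fp g =ᶠ[𝓝[≠] ((3 : ℂ) / 2)] fun z => (z - (3 : ℂ) / 2) * Ec z g)
      (f : (quasiSplit (↥(maximalRealSubfield L)) L (IsCMField.complexConj L) 3).L2 μ) (_ : (f : (quasiSplit (↥(maximalRealSubfield L)) L (IsCMField.complexConj L) 3).automorphicQuotient → ℂ) =ᵐ[μ] fun x => Fp (Quotient.out (x : (quasiSplit (↥(maximalRealSubfield L)) L (IsCMField.complexConj L) 3).Adelic ⧸ (quasiSplit (↥(maximalRealSubfield L)) L (IsCMField.complexConj L) 3).quotientSubgroup))⁻¹ ((3 : ℂ) / 2))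
      (ν : Measure ↥(adelicUnipotent (↥(maximalRealSubfield L)) L (IsCMField.complexConj L) 3)) (_ : ν.IsHaarMeasure) (𝓕 : Set ↥(adelicUnipotent (↥(maximalRealSubfield L)) L (IsCMField.complexConj L) 3)) (_ : IsFundamentalDomain ↥(rationalUnipotent (↥(maximalRealSubfield L)) L (IsCMField.complexConj L) 3) 𝓕 ν) (_ : IsCompact (closure 𝓕)) (_ : ν.IsInvInvariant) (_ : ν 𝓕 = 1),
      ∃ (Ag : (quasiSplit (↥(maximalRealSubfield L)) L (IsCMField.complexConj L) 3).Adelic → ℂ → ℂ) (M : ℝ),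
        (∀ g, DifferentiableOn ℂ (Ag g) {z : ℂ | 1 < z.re}) ∧ (∀ g, ‖Ag g (3 / 2)‖ ≤ M) ∧
        (∀ z : ℂ, 2 < z.re → ∀ g : (quasiSplit (↥(maximalRealSubfield L)) L (IsCMField.complexConj L) 3).Adelic, (borelConstantTerm ν 𝓕 (Ec z) g - φ g * (((borelHeight g : ℝ≥0) : ℝ) : ℂ) ^ z) / (((borelHeight g : ℝ≥0) : ℝ) : ℂ) ^ (2 - z) = Ag g z *
          ((partialStandardL S (fun w => {(ξ.bcη⁻¹ * μω).valueAtUniformizer w}) (z - 1) * partialStandardL T' (fun v => {(1 : HeckeCharacter ↥(maximalRealSubfield L)).valueAtUniformizer v}) (2 * z - 2)) /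
            (partialStandardL S (fun w => {(ξ.bcη⁻¹ * μω).valueAtUniformizer w}) z * partialStandardL T' (fun v => {(1 : HeckeCharacter ↥(maximalRealSubfield L)).valueAtUniformizer v}) (2 * z - 1)))) ∧
        (Measurable fun g : (quasiSplit (↥(maximalRealSubfield L)) L (IsCMField.complexConj L) 3).Adelic => Ag g ((3 : ℂ) / 2)) ∧
        (∀ b ∈ arithmeticBorel (↥(maximalRealSubfield L)) L (IsCMField.complexConj L) 3, ∀ x : (quasiSplit (↥(maximalRealSubfield L)) L (IsCMField.complexConj L) 3).Adelic, Ag ((b : (quasiSplit (↥(maximalRealSubfield L)) L (IsCMField.complexConj L) 3).Adelic) * x) ((3 : ℂ) / 2) = Ag x ((3 : ℂ) / 2)) ∧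
        (∀ (u : ↥(adelicUnipotent (↥(maximalRealSubfield L)) L (IsCMField.complexConj L) 3)) (g : (quasiSplit (↥(maximalRealSubfield L)) L (IsCMField.complexConj L) 3).Adelic), Ag ((u : (quasiSplit (↥(maximalRealSubfield L)) L (IsCMField.complexConj L) 3).Adelic) * g) ((3 : ℂ) / 2) = Ag g ((3 : ℂ) / 2)) :=
  hSCALrows_of_unfoldingRows L μ μω hμu ξ _ (scalarRatio_one_ne_zero S T' (isUnitary_bcηInv_mul L ξ hμu)) hUNF

end OfRecord

end Summit.HodgeConjecture.HodgeConjecture.Cruxes.H413.K2E1ChiScalarRowsOfRecordU3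

end
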